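import Summits.QuantumFields.BalabanUV.Beta.D1BFx.FineHessianLegGrades
import Summits.QuantumFields.BalabanUV.Beta.D1BFx.GhostKernelComplete

/-!
# `BalabanUV.Beta.D1BFx.FineHessianGhostGrades` — road «BF-x» for binder row D1, leaf A0 (fine level), GHOST TWIN (A0-FINE-gh): THE SECTOR ×
# FROZEN-LEG SPLIT OF THE GHOST PIECE OF RECORD — `fineHessGhQ n a x₀ cK cQ = ½·tadpole (Ggh) (WghAt …) − ½·bubble (Ggh) (SghAt …) (SghAt …)`
# with `SghAt = cK•ghCur + cQ•qAntiAt` (KIN + averaging-jet block) and the scalar leg `Ggh = frozenLeg g + (Ggh − frozenLeg g)` (fibre `Unit`):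
# 2 tadpole words + 16 bubble words, each an admissible (F)/(CONV) integrand of `D1BFx.Assembly`; the word KIN·KIN·(frozen, frozen) is MAIN-gh's parent

HONEST DEPENDENCY (page 1, mandatory): continuum YM on T⁴ ⇐ BetaPertH ∧ nine spine estimates (0/9 proved); BetaPertH ⇐ (D1) ∧ (D4) ∧
CAP+tail; G-an2-4 gates asym, D1 and NE2/3/4.  HONEST FRAMING (cell contract, verbatim): «discharging `BetaPertH` makes Bałaban's UV
stability UNCONDITIONAL — a real constructive-QFT result; it is NOT the continuum limit and NOT the Clay problem.»  THIS MODULE DISCHARGES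
NOTHING of the wall: THREE definitions with bodies ([our objects] the `Fin 2` packers `ghSec n` (KIN, averaging-jet block), `ghWt cK cQ`, and
`ghLeg n a g` (frozen leg, difference)) and [folklore] LINEAR ALGEBRA OF ABSOLUTELY CONVERGENT LATTICE SUMS composed BY NAME over A0-FINE parts
1–2 (`FineHessianSectors.biBubbleTable`/`bubble_weightedSum_weightedSum`, `FineHessianLegGrades.frozenLeg`/`biBubbleTable_add_add`/
`tadpoleTableA_add_leg`/`spr_frozenLeg`/`spr_sub'`), leaf-01-g2's `DressedTablesLeg` (`fineHessA`, `bubbleTableA`, `tadpoleTableA`), the ghost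
objects of record (typer T2 `GhostLeg.Ggh`/`spr_Ggh`/`shiftK_Ggh_neg`, T6 `GhostStencil.ghCur`/`biLoc_ghCur`, leaf-01's `GhostStencilRooted.SghAt`/
`qAntiAt`/`biLoc_qAntiAt`, leaf-04-g2/leaf-02-g2's `GhostKernelComplete.fineHessGhQ`/`WghAt`/`biLoc_WghAt_ctr`, `ctrHalf_mem`).  No `Prop` is minted,
nothing is cited, no hypothesis is a printed statement, 0 sorry.  0 wall binders instantiated; NOT the (SPLIT) slot, NOT D1, NOT `BetaPertH`,
NOT continuum, NOT Clay.

ABSOLUTE RULE (cell charter, verbatim): «No internally-minted statement may enter as a cited fact. Every hypothesis is either kernel-proved in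
this package or a verbatim quotation of a PUBLISHED theorem with page reference. The manuscript(s) under audit are NOT citable for their own
disputed steps — they are the thing under adjudication; programme-internal (2001/route/tribunal) claims are never citable.»

WHY (owner's `SPLIT-SPEC.md` v1 a41e5f8c78600ad5 §3 «Ghost piece … leg `Ggh = B_b + E^gh_b`, `B_b := frozenLeg (…)` … MAIN-gh := −½·cK²·bubble B_b (KIN μ (b+w)) (KIN ν b)
…; REST: `KIN × qAntiAt` (A3.a-gh), `qAntiAt × qAntiAt` (A3.b-gh), graded-leg words (A3.c-gh), tadpole `WghAt`», §4 «Ghost twin (A0-FINE-gh): same over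
`fineHessGhQ` — first refusal leaf-03-g3»).  The ghost piece of record enters slot (F) through `AssemblySlots.hF_PghQ_ray` with the integrand
`n⁻⁸·w_μw_ν·baseKer (fineHessGhQ n a x₀ cK cQ μ ν) b w`.  THIS FILE writes that integrand, for ANY exponentially bounded frozen profile `g` (the road
takes the re-legged `Gf n b` or the ghost's own diagonal `v ↦ Ggh n a b (b + v)`), as 2 tadpole words `½·tadpole (ghLeg r) (WghAt …)` + 16 bubble words
`−½·biBubble (ghLeg r) (ghSec i …) (ghLeg r′) (ghSec j …)` weighted by `ghWt i · ghWt j`, each block-periodic with absolutely second-moment-summable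
base-point kernels — the ghost fibre is `Unit`, so `offPart = 0` and the leg split has two pieces only.  MAIN-gh's parent is `(i,j,r,r′) = (KIN,KIN,0,0)`,
which the owner's `GhostCurrentRealised.bubble_ghCur_ghCur_frozen` (leg hypothesis `hB` := `frozenLeg_apply`) turns into `2·cellForm g`.

CONTENT (`n` block side `[NeZero n]`, weight `a > 0` where the leg's spread is needed).
* §1 [our objects] `ghSec n : Fin 2 → …` (`0 ↦ ghCur`, `1 ↦ qAntiAt (ctrHalf n) n`), `ghWt cK cQ := ![cK, cQ]`; [folklore] `SghAt_ctr_eq_secSum`, `loc_ghSec`,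
  **`bubbleTableA_SghAt_eq_secSum`** (4 two-leg sector words over the full leg `Ggh`).
* §2 [our object] `ghLeg n a g : Fin 2 → MKer 4 Unit` (`0 ↦ frozenLeg g`, `1 ↦ Ggh n a − frozenLeg g`); [folklore] `Ggh_eq_sum_ghLeg`, `decay_GghDiagEntry`, `spr_ghLeg`,
  `shiftK_ghLeg_neg`, **`biBubbleTable_Ggh_eq_pieceSum`** (4 words), **`tadpoleTableA_Ggh_eq_pieceSum`** (2 words).
* §3 [folklore] **`fineHessGhQ_eq_gradedTerms`** (2 + 16 words), **`Kf_ghost_eq_gradedTerms`** (the (F)-integrand form), (CONV) per word (`conv_tadpoleTableA_ghost`,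
  `conv_biBubbleTable_ghost`).
NOT HERE (honest): MAIN-gh's identification with `cellForm`/`stK` (owner (5e)), the choice of `g`, any bound, loop weights.  Unit
`b2b-balaban-beta-d1-formalise-leaf-03` (gen 3); `LEAVES-BFx.md` row A0 (sub-leaf A0-FINE-gh).
-/

noncomputable section

namespace Summit.QuantumFields.BalabanUV.Beta.D1BFx.FineHessianGhostGrades

open Finset Filter Topology
open scoped BigOperators
open Literature.MathematicalPhysics.QuantumFieldTheory.Balaban1983to89
open Literature.MathematicalPhysics.QuantumFieldTheory.Balaban1983to89.Beta
open B12Sec2to5 (l1 l1_nonneg)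
open ExpKernelCalculus (Site MKer Decays BiLoc bubble tadpole shiftK l1_sub_symm)
open DecimatedMomentSummable (AbsMoment₂)
open WindowIdentification (psum)
open DyadicShell (Pt toReal)
open Summit.QuantumFields.BalabanUV.Beta.TameKernelCalculus
open Summit.QuantumFields.BalabanUV.Beta.D1BFx.GhostLeg (Ggh spr_Ggh shiftK_Ggh_neg)
open Summit.QuantumFields.BalabanUV.Beta.D1BFx.GhostStencil (ghCur biLoc_ghCur)
open Summit.QuantumFields.BalabanUV.Beta.D1BFx.GhostStencilRooted (SghAt qAntiAt biLoc_qAntiAt)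
open Summit.QuantumFields.BalabanUV.Beta.D1BFx.GhostStencilRootedReflection (ctrHalf ctrHalf_mem)
open Summit.QuantumFields.BalabanUV.Beta.D1BFx.GhostAveragingSquare (WghAt)
open Summit.QuantumFields.BalabanUV.Beta.D1BFx.GhostKernelComplete (fineHessGhQ fineHessGhQ_eq biLoc_WghAt_ctr)
open Summit.QuantumFields.BalabanUV.Beta.D1BFx.DressedTablesLeg (bubbleTableA bubbleTableA_apply tadpoleTableA absMoment₂_baseKer_tadpoleTableA)
open Summit.QuantumFields.BalabanUV.Beta.D1BFx.ReducedKernelSandwichLeg (fineHessA fineHessA_apply)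
open Summit.QuantumFields.BalabanUV.Beta.D1BFx.MomentTransferPeriodic (baseKer)
open Summit.QuantumFields.BalabanUV.Beta.D1BFx.Assembly (exists_tendsto_psum_weight_mul exists_tendsto_psum_const_mul)
open Summit.QuantumFields.BalabanUV.Beta.D1BFx.FineHessianSectors (biBubbleTable biBubbleTable_apply absMoment₂_baseKer_biBubbleTable
  bubble_weightedSum_weightedSum)
open Summit.QuantumFields.BalabanUV.Beta.D1BFx.FineHessianLegGrades (frozenLeg frozenLeg_apply spr_frozenLeg shiftK_frozenLeg spr_sub'
  biBubbleTable_add_add tadpoleTableA_add_leg)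

variable (n : ℕ) [NeZero n] (a : ℝ)

/-! ## §1 The two ghost sectors and the sector expansion of the ghost bubble table -/

/-- [our object] THE TWO GHOST SECTORS of the centre-rooted stencil of record, packed as a `Fin 2`-family: `0 ↦ ghCur` (KIN, the ghost-kinetic
current — MAIN-gh's stencil), `1 ↦ qAntiAt (ctrHalf n) n` (the averaging-jet block, A3.a-gh/A3.b-gh).  A DEFINITION; asserts nothing. -/
def ghSec (n : ℕ) : Fin 2 → (Fin 4 → Site 4 → MKer 4 Unit) := ![ghCur, qAntiAt (ctrHalf n) n]

/-- [our object] The two ghost sector weights: `0 ↦ cK`, `1 ↦ cQ`. -/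
def ghWt (cK cQ : ℝ) : Fin 2 → ℝ := ![cK, cQ]

variable (cK cQ x₀ : ℝ)

omit [NeZero n] in
/-- [our object] Unfolding. -/ theorem ghSec_zero : ghSec n 0 = ghCur := rfl
omit [NeZero n] in
/-- [our object] Unfolding. -/ theorem ghSec_one : ghSec n 1 = qAntiAt (ctrHalf n) n := rfl
/-- [our object] Unfolding. -/ theorem ghWt_zero : ghWt cK cQ 0 = cK := rfl
/-- [our object] Unfolding. -/ theorem ghWt_one : ghWt cK cQ 1 = cQ := rfl

omit [NeZero n] in
/-- [folklore] **THE GHOST STENCIL OF RECORD IS THE WEIGHTED SUM OF ITS TWO SECTORS** (definitional; cf. the owner's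
`GhostCurrentRealised.SghAt_split`, which further realises KIN as `realK … ghostStn`). -/
theorem SghAt_ctr_eq_secSum (κ : Fin 4) (u : Site 4) :
    SghAt (ctrHalf n) n cK cQ κ u = ∑ i : Fin 2, ghWt cK cQ i • ghSec n i κ u := by
  funext x z p q
  simp only [Fin.sum_univ_two, ghWt_zero, ghWt_one, ghSec_zero, ghSec_one, Pi.add_apply, Pi.smul_apply, smul_eq_mul]
  rfl

/-- [folklore] Both ghost sectors are localised at their bond (`biLoc_ghCur` at rate `1`; `biLoc_qAntiAt` at the in-block root `ctrHalf_mem`, rate `1/n`). -/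
theorem loc_ghSec (i : Fin 2) (κ : Fin 4) (u : Site 4) : Loc (ghSec n i κ u) := by
  fin_cases i
  · exact ⟨u, u, _, 1, one_pos, biLoc_ghCur κ u 1⟩
  · have hn : (0 : ℝ) < 1 / (n : ℝ) := div_pos one_pos (by exact_mod_cast Nat.pos_of_ne_zero (NeZero.ne n))
    exact ⟨u, u, _, _, hn, biLoc_qAntiAt n κ u (ctrHalf_mem n) zero_le_one⟩

/-- [folklore] **THE SECTOR EXPANSION OF THE GHOST FINE BUBBLE TABLE** (spread leg): FOUR two-leg sector words
`bubbleTableA A (SghAt …) κ′ λ′ u u′ = Σ_{i j : Fin 2} ghWt i · ghWt j · biBubbleTable A A (ghSec i) (ghSec j) κ′ λ′ u u′` (KIN·KIN, KIN·Q, Q·KIN, Q·Q). -/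
theorem bubbleTableA_SghAt_eq_secSum {A : MKer 4 Unit} (hA : Spr A) (κ' l' : Fin 4) (u u' : Site 4) :
    bubbleTableA A (SghAt (ctrHalf n) n cK cQ) κ' l' u u' =
      ∑ i : Fin 2, ∑ j : Fin 2, ghWt cK cQ i * ghWt cK cQ j * biBubbleTable A A (ghSec n i) (ghSec n j) κ' l' u u' := by
  rw [bubbleTableA_apply, SghAt_ctr_eq_secSum, SghAt_ctr_eq_secSum,
    bubble_weightedSum_weightedSum univ univ hA _ _ (fun i => loc_ghSec n i κ' u) (fun j => loc_ghSec n j l' u'), Finset.mul_sum]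
  refine Finset.sum_congr rfl fun i _ => ?_
  rw [Finset.mul_sum]
  refine Finset.sum_congr rfl fun j _ => ?_
  rw [biBubbleTable_apply, ← PackedKernelSplit.bubble_eq_biBubble]
  ring

/-! ## §2 The two leg pieces of the ghost leg (fibre `Unit`: no off-diagonal part) -/

/-- [our object] THE TWO LEG PIECES OF THE GHOST LEG at a frozen scalar profile `g`: `0 ↦ frozenLeg g` (MAIN-gh's leg), `1 ↦ Ggh n a − frozenLeg g`
(the graded difference; A3.c-gh after A2′ re-legging).  A DEFINITION; asserts nothing. -/
def ghLeg (n : ℕ) [NeZero n] (a : ℝ) (g : Site 4 → ℝ) : Fin 2 → MKer 4 Unit := ![frozenLeg g, Ggh n a - frozenLeg g]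

variable (g : Site 4 → ℝ)

/-- [our object] Unfolding. -/ theorem ghLeg_zero : ghLeg n a g 0 = frozenLeg g := rfl
/-- [our object] Unfolding. -/ theorem ghLeg_one : ghLeg n a g 1 = Ggh n a - frozenLeg g := rfl

/-- [folklore] **THE GHOST LEG IS THE SUM OF ITS TWO PIECES** (any `g`). -/
theorem Ggh_eq_sum_ghLeg : Ggh n a = ∑ r : Fin 2, ghLeg n a g r := by
  rw [Fin.sum_univ_two, ghLeg_zero, ghLeg_one, add_sub_cancel]

/-- [folklore] **A DIAGONAL PROFILE OF THE SPREAD GHOST LEG DECAYS** (`0 < a`; `GhostLeg.spr_Ggh`): the ghost's own frozen profile `v ↦ Ggh n a b (b + v)`. -/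
theorem decay_GghDiagEntry (ha : 0 < a) (b : Site 4) :
    ∃ C δ : ℝ, 0 < δ ∧ ∀ v : Site 4, |Ggh n a b (b + v) () ()| ≤ C * Real.exp (-δ * l1 v) := by
  obtain ⟨C, δ, hδ, h⟩ := spr_Ggh n a ha
  refine ⟨C, δ, hδ, fun v => ?_⟩
  simpa [show b - (b + v) = -v by abel, show l1 (-v) = l1 v by simpa using l1_sub_symm (0 : Site 4) v] using h b (b + v) () ()

variable {g}

/-- [folklore] **BOTH PIECES ARE SPREAD** (`0 < a`, exponentially bounded profile). -/
theorem spr_ghLeg (ha : 0 < a) {C δ : ℝ} (hδ : 0 < δ) (hg : ∀ v, |g v| ≤ C * Real.exp (-δ * l1 v)) (r : Fin 2) : Spr (ghLeg n a g r) := by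
  fin_cases r
  · exact spr_frozenLeg hδ hg
  · exact spr_sub' (spr_Ggh n a ha) (spr_frozenLeg hδ hg)

/-- [folklore] **BOTH PIECES ARE BLOCK-COVARIANT** (`0 < a`; `GhostLeg.shiftK_Ggh_neg`, translation invariance of the frozen leg). -/
theorem shiftK_ghLeg_neg (ha : 0 < a) (r : Fin 2) (t : Site 4) : shiftK (-((n : ℤ) • t)) (ghLeg n a g r) = ghLeg n a g r := by
  fin_cases r
  · exact shiftK_frozenLeg _ g
  · show shiftK (-((n : ℤ) • t)) (Ggh n a) - shiftK (-((n : ℤ) • t)) (frozenLeg g) = Ggh n a - frozenLeg g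
    rw [shiftK_Ggh_neg n a ha, shiftK_frozenLeg]

/-- [folklore] **THE FROZEN-LEG SPLIT OF A TWO-SECTOR GHOST TABLE**: FOUR WORDS `biBubbleTable Ggh Ggh S T = Σ_{r r′ : Fin 2} biBubbleTable (ghLeg r) (ghLeg r′) S T`
entrywise (spread `Ggh`, exponentially bounded profile, localised stencil entries). -/
theorem biBubbleTable_Ggh_eq_pieceSum (ha : 0 < a) {C δ : ℝ} (hδ : 0 < δ) (hg : ∀ v, |g v| ≤ C * Real.exp (-δ * l1 v))
    {S T : Fin 4 → Site 4 → MKer 4 Unit} (hS : ∀ κ u, Loc (S κ u)) (hT : ∀ κ u, Loc (T κ u)) (κ' l' : Fin 4) (u u' : Site 4) :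
    biBubbleTable (Ggh n a) (Ggh n a) S T κ' l' u u' = ∑ r : Fin 2, ∑ r' : Fin 2, biBubbleTable (ghLeg n a g r) (ghLeg n a g r') S T κ' l' u u' := by
  have h0 : Spr (ghLeg n a g 0) := spr_ghLeg n a ha hδ hg 0
  have h1 : Spr (ghLeg n a g 1) := spr_ghLeg n a ha hδ hg 1
  conv_lhs => rw [Ggh_eq_sum_ghLeg n a g, Fin.sum_univ_two]
  rw [biBubbleTable_add_add h0 h1 h0 h1 hS hT]
  simp only [Fin.sum_univ_two]

/-- [folklore] **THE FROZEN-LEG SPLIT OF THE GHOST TADPOLE TABLE**: TWO WORDS per table. -/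
theorem tadpoleTableA_Ggh_eq_pieceSum (ha : 0 < a) {C δ : ℝ} (hδ : 0 < δ) (hg : ∀ v, |g v| ≤ C * Real.exp (-δ * l1 v))
    {W : Fin 4 → Site 4 → Fin 4 → Site 4 → MKer 4 Unit} (hW : ∀ κ u l u', Loc (W κ u l u')) (κ' l' : Fin 4) (u u' : Site 4) :
    tadpoleTableA (Ggh n a) W κ' l' u u' = ∑ r : Fin 2, tadpoleTableA (ghLeg n a g r) W κ' l' u u' := by
  conv_lhs => rw [Ggh_eq_sum_ghLeg n a g, Fin.sum_univ_two]
  rw [tadpoleTableA_add_leg (spr_ghLeg n a ha hδ hg 0) (spr_ghLeg n a ha hδ hg 1) hW, Fin.sum_univ_two]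

/-! ## §3 The graded term list of the ghost piece of record; the (F)-integrand form; (CONV) per word -/

/-- [folklore] Every entry of the completed ghost table is localised (`biLoc_WghAt_ctr`, rate `1/n`). -/
theorem loc_WghAt_ctr (κ : Fin 4) (u : Site 4) (l : Fin 4) (u' : Site 4) : Loc (WghAt (ctrHalf n) n x₀ cK cQ κ u l u') := by
  have hn : (0 : ℝ) < 1 / (n : ℝ) := div_pos one_pos (by exact_mod_cast Nat.pos_of_ne_zero (NeZero.ne n))
  exact ⟨u, u', _, _, hn, biLoc_WghAt_ctr n x₀ cK cQ κ u l u'⟩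

/-- [folklore] **A0 AT THE FINE LEVEL, GHOST TWIN — THE GHOST PIECE OF RECORD AS 2 TADPOLE WORDS + 16 BUBBLE WORDS**: sectors {KIN, Q}² × legs
{frozen, difference}², plus the completed table's tadpole over the two legs, for ANY exponentially bounded frozen profile `g` (`0 < a`). -/
theorem fineHessGhQ_eq_gradedTerms (ha : 0 < a) {C δ : ℝ} (hδ : 0 < δ) (hg : ∀ v, |g v| ≤ C * Real.exp (-δ * l1 v))
    (κ' l' : Fin 4) (u u' : Site 4) :
    fineHessGhQ n a x₀ cK cQ κ' l' u u' =
      (∑ r : Fin 2, tadpoleTableA (ghLeg n a g r) (WghAt (ctrHalf n) n x₀ cK cQ) κ' l' u u') +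
        ∑ i : Fin 2, ∑ j : Fin 2, ∑ r : Fin 2, ∑ r' : Fin 2, ghWt cK cQ i * ghWt cK cQ j *
          biBubbleTable (ghLeg n a g r) (ghLeg n a g r') (ghSec n i) (ghSec n j) κ' l' u u' := by
  rw [fineHessGhQ_eq, fineHessA_apply, tadpoleTableA_Ggh_eq_pieceSum n a ha hδ hg (loc_WghAt_ctr n cK cQ x₀),
    bubbleTableA_SghAt_eq_secSum n cK cQ (spr_Ggh n a ha)]
  congr 1
  refine Finset.sum_congr rfl fun i _ => Finset.sum_congr rfl fun j _ => ?_
  rw [biBubbleTable_Ggh_eq_pieceSum n a ha hδ hg (loc_ghSec n i) (loc_ghSec n j), Finset.mul_sum]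
  refine Finset.sum_congr rfl fun r _ => ?_
  rw [Finset.mul_sum]

/-- [folklore] **THE GHOST PIECE'S (F)-INTEGRAND, GRADED**: `n⁻⁸·w_μw_ν·baseKer (fineHessGhQ …) b w` (`AssemblySlots.hF_PghQ_ray`'s integrand, any
weights) as the weighted combination of the 2 + 16 graded word integrands. -/
theorem Kf_ghost_eq_gradedTerms (ha : 0 < a) {C δ : ℝ} (hδ : 0 < δ) (hg : ∀ v, |g v| ≤ C * Real.exp (-δ * l1 v)) (μ ν : Fin 4) (b w : Pt) :
    ((n : ℝ) ^ 8)⁻¹ * (toReal w μ * toReal w ν * baseKer (fineHessGhQ n a x₀ cK cQ μ ν) b w) =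
      (∑ r : Fin 2, ((n : ℝ) ^ 8)⁻¹ * (toReal w μ * toReal w ν * baseKer (tadpoleTableA (ghLeg n a g r) (WghAt (ctrHalf n) n x₀ cK cQ) μ ν) b w)) +
        ∑ i : Fin 2, ∑ j : Fin 2, ∑ r : Fin 2, ∑ r' : Fin 2, ghWt cK cQ i * ghWt cK cQ j *
          (((n : ℝ) ^ 8)⁻¹ * (toReal w μ * toReal w ν *
            baseKer (biBubbleTable (ghLeg n a g r) (ghLeg n a g r') (ghSec n i) (ghSec n j) μ ν) b w)) := by
  have h := fineHessGhQ_eq_gradedTerms n a cK cQ x₀ ha hδ hg μ ν (b + w) b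
  simp only [baseKer]
  rw [h]
  simp only [mul_add, Finset.mul_sum]
  congr 1
  exact Finset.sum_congr rfl fun i _ => Finset.sum_congr rfl fun j _ => Finset.sum_congr rfl fun r _ =>
    Finset.sum_congr rfl fun r' _ => by ring

/-- [folklore] **(CONV) FOR BOTH GHOST TADPOLE WORDS** (`0 < a`, exponentially bounded profile; the completed table is uniformly bi-localised). -/
theorem conv_tadpoleTableA_ghost (ha : 0 < a) {C δ : ℝ} (hδ : 0 < δ) (hg : ∀ v, |g v| ≤ C * Real.exp (-δ * l1 v)) (r : Fin 2)
    (μ ν : Fin 4) (b : Pt) :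
    ∃ B, Tendsto (psum (fun w : Pt => ((n : ℝ) ^ 8)⁻¹ *
      (toReal w μ * toReal w ν * baseKer (tadpoleTableA (ghLeg n a g r) (WghAt (ctrHalf n) n x₀ cK cQ) μ ν) b w))) atTop (𝓝 B) := by
  have hn : (0 : ℝ) < 1 / (n : ℝ) := div_pos one_pos (by exact_mod_cast Nat.pos_of_ne_zero (NeZero.ne n))
  exact exists_tendsto_psum_const_mul _ (exists_tendsto_psum_weight_mul
    (absMoment₂_baseKer_tadpoleTableA (ghLeg n a g r) (spr_ghLeg n a ha hδ hg r) (biLoc_WghAt_ctr n x₀ cK cQ) hn μ ν b) μ ν)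

/-- [folklore] **(CONV) FOR ALL 16 GHOST BUBBLE WORDS** (`0 < a`, exponentially bounded profile). -/
theorem conv_biBubbleTable_ghost (ha : 0 < a) {C δ : ℝ} (hδ : 0 < δ) (hg : ∀ v, |g v| ≤ C * Real.exp (-δ * l1 v))
    (r r' i j : Fin 2) (μ ν : Fin 4) (b : Pt) :
    ∃ B, Tendsto (psum (fun w : Pt => ((n : ℝ) ^ 8)⁻¹ * (toReal w μ * toReal w ν *
      baseKer (biBubbleTable (ghLeg n a g r) (ghLeg n a g r') (ghSec n i) (ghSec n j) μ ν) b w))) atTop (𝓝 B) := by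
  have hn : (0 : ℝ) < 1 / (n : ℝ) := div_pos one_pos (by exact_mod_cast Nat.pos_of_ne_zero (NeZero.ne n))
  have hsec : ∀ k : Fin 2, ∃ Cs δs : ℝ, 0 < δs ∧ ∀ κ u, BiLoc (ghSec n k κ u) u u Cs δs := by
    intro k
    fin_cases k
    · exact ⟨_, 1, one_pos, fun κ u => biLoc_ghCur κ u 1⟩
    · exact ⟨_, _, hn, fun κ u => biLoc_qAntiAt n κ u (ctrHalf_mem n) zero_le_one⟩
  obtain ⟨Cs, δs, hδs, hS⟩ := hsec i
  obtain ⟨Ct, δt, hδt, hT⟩ := hsec j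
  exact exists_tendsto_psum_const_mul _ (exists_tendsto_psum_weight_mul
    (absMoment₂_baseKer_biBubbleTable (ghLeg n a g r) (ghLeg n a g r') (spr_ghLeg n a ha hδ hg r) (spr_ghLeg n a ha hδ hg r')
      hS hδs hT hδt μ ν b) μ ν)

end Summit.QuantumFields.BalabanUV.Beta.D1BFx.FineHessianGhostGrades

end
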